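import Mathlib
import HarnessLib
import Summits.QuantumAdvantage.QuantumAdvantage.Theses.AmplitudeProofs
import Literature.Computability.Complexity.Promise
import Literature.Computability.Cryptography.ClassBQP

/-!
# Birth skeleton for piece X₃ `ApcUniversal` (support; split `np-cut` of crux `ApcThesis`, stmt-QuantumAdvantage-2697)

Piece X₃ (TRUE in print) = a universal gap-preserving uniform oracle-free Clifford+T family on instance codes
`⟨⟨C⟩, x⟩`.  Line "approximate universality + promise gap amplification" — the two standard engines kept apart:

* `stub_approxUniversal` (TRUE: programmable/universal circuit, Nielsen–Chuang 2010 §4.5; the controlled gadgets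
  c-H, c-S, c-T, Toffoli have entries in `ℤ[1/√2, i]` hence EXACT Clifford+T circuits with one ancilla,
  Giles–Selinger 2013 (arXiv:1212.0506) — so even error `0` is available; `1/12` leaves room for approximate
  gadget compilations à la Solovay–Kitaev): a uniform oracle-free family `E` whose acceptance probability on
  the code `⟨⟨C⟩,x⟩` is within `1/12` of `Pr[C accepts x]`;
* `stub_promiseGapAmplification` (TRUE: majority vote over parallel copies, Chernoff/Chebyshev — the promise-level
  form of the tree theorem `BQPWith_subset_BQPWith_of_lt_half` (BBBV97 Thm 4.13), which is stated for languages):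
  any constant gap `(a, b)`, `b < a`, on a promise problem can be amplified to `(2/3, 1/3)`;
* `ApcUniversal_of` (kernel-checked): `E` decides the gap-acceptance promise problem with gap `(7/12, 5/12)`,
  amplification puts it in `PromiseBQP`, and a `PromiseBQP` family for it IS the universal family of X₃.
Sources: NielsenChuang2010 §4.5; GilesSelinger2013 (arXiv:1212.0506); BennettBernsteinBrassardVazirani1997 Thm 4.13; Watrous2009 §III.2.
-/

set_option linter.dupNamespace false

namespace Summit.QuantumAdvantage.QuantumAdvantage.Cruxes.ApcThesis.NpCut.Universal

open _root_.Computability Literature.Computability.Complexity Literature.Computability.Cryptography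

/-- **stub 1 (TRUE in print).** An approximately universal uniform oracle-free Clifford+T family on codes. -/
theorem stub_approxUniversal : ∃ E : Literature.Computability.Cryptography.QCircuitFamily Literature.Computability.Cryptography.cliffordT, E.IsOracleFree ∧ E.IsUniform ∧ ∀ (n m : ℕ) (C : Literature.Computability.Cryptography.QCircuit Literature.Computability.Cryptography.cliffordT (n + m)) (x : Literature.Computability.Cryptography.QReg n), C.IsOracleFree → |E.acceptProbOn 0 (Literature.Computability.Complexity.boolPair (Literature.Computability.Cryptography.QCircuit.sigmaEncode ⟨n, m, C⟩) (List.ofFn x)) - C.acceptProb 0 x| ≤ (1 : ℝ) / 12 := by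
  sorry

/-- **stub 2 (TRUE in print).** Constant-gap amplification for promise problems over uniform Clifford+T families. -/
theorem stub_promiseGapAmplification : ∀ (Q : Literature.Computability.Complexity.PromiseProblem) (a b : ℝ), b < a → (∃ F : Literature.Computability.Cryptography.QCircuitFamily Literature.Computability.Cryptography.cliffordT, F.IsOracleFree ∧ F.IsUniform ∧ (∀ x ∈ Q.yes, a ≤ F.acceptProbOn 0 x) ∧ (∀ x ∈ Q.no, F.acceptProbOn 0 x ≤ b)) → Q ∈ Literature.Computability.Cryptography.PromiseBQP := by
  sorry

/-- The gap-acceptance promise problem of oracle-free Clifford+T circuits. -/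
def apcPromise : PromiseProblem where
  yes := {s | ∃ (n m : ℕ) (C : QCircuit cliffordT (n + m)) (x : QReg n), C.IsOracleFree ∧
    s = boolPair (QCircuit.sigmaEncode ⟨n, m, C⟩) (List.ofFn x) ∧ (2 : ℝ) / 3 ≤ C.acceptProb 0 x}
  no := {s | ∃ (n m : ℕ) (C : QCircuit cliffordT (n + m)) (x : QReg n), C.IsOracleFree ∧
    s = boolPair (QCircuit.sigmaEncode ⟨n, m, C⟩) (List.ofFn x) ∧ C.acceptProb 0 x ≤ (1 : ℝ) / 3}

/-- From the two stubs: the gap-acceptance promise problem is in `PromiseBQP`. -/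
theorem apcPromise_mem_PromiseBQP_of (h₁ : ∃ E : Literature.Computability.Cryptography.QCircuitFamily Literature.Computability.Cryptography.cliffordT, E.IsOracleFree ∧ E.IsUniform ∧ ∀ (n m : ℕ) (C : Literature.Computability.Cryptography.QCircuit Literature.Computability.Cryptography.cliffordT (n + m)) (x : Literature.Computability.Cryptography.QReg n), C.IsOracleFree → |E.acceptProbOn 0 (Literature.Computability.Complexity.boolPair (Literature.Computability.Cryptography.QCircuit.sigmaEncode ⟨n, m, C⟩) (List.ofFn x)) - C.acceptProb 0 x| ≤ (1 : ℝ) / 12) (h₂ : ∀ (Q : Literature.Computability.Complexity.PromiseProblem) (a b : ℝ), b < a → (∃ F : Literature.Computability.Cryptography.QCircuitFamily Literature.Computability.Cryptography.cliffordT, F.IsOracleFree ∧ F.IsUniform ∧ (∀ x ∈ Q.yes, a ≤ F.acceptProbOn 0 x) ∧ (∀ x ∈ Q.no, F.acceptProbOn 0 x ≤ b)) → Q ∈ Literature.Computability.Cryptography.PromiseBQP) : apcPromise ∈ PromiseBQP := by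
  obtain ⟨E, hEo, hEu, hE⟩ := h₁
  refine h₂ apcPromise ((7 : ℝ) / 12) ((5 : ℝ) / 12) (by norm_num) ⟨E, hEo, hEu, ?_, ?_⟩
  · rintro s ⟨n, m, C, x, hC, rfl, hacc⟩
    have h := (abs_le.1 (hE n m C x hC)).1
    linarith
  · rintro s ⟨n, m, C, x, hC, rfl, hacc⟩
    have h := (abs_le.1 (hE n m C x hC)).2
    linarith

/-- A `PromiseBQP` family for the gap-acceptance promise problem is a universal gap-preserving family. -/
theorem apcUniversal_of_mem_PromiseBQP (h : apcPromise ∈ PromiseBQP) : ∃ U : Literature.Computability.Cryptography.QCircuitFamily Literature.Computability.Cryptography.cliffordT, U.IsOracleFree ∧ U.IsUniform ∧ ∀ (n m : ℕ) (C : Literature.Computability.Cryptography.QCircuit Literature.Computability.Cryptography.cliffordT (n + m)) (x : Literature.Computability.Cryptography.QReg n), C.IsOracleFree → ((2 : ℝ) / 3 ≤ C.acceptProb 0 x → (2 : ℝ) / 3 ≤ U.acceptProbOn 0 (Literature.Computability.Complexity.boolPair (Literature.Computability.Cryptography.QCircuit.sigmaEncode ⟨n, m, C⟩) (List.ofFn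 x))) ∧ (C.acceptProb 0 x ≤ (1 : ℝ) / 3 → U.acceptProbOn 0 (Literature.Computability.Complexity.boolPair (Literature.Computability.Cryptography.QCircuit.sigmaEncode ⟨n, m, C⟩) (List.ofFn x)) ≤ (1 : ℝ) / 3) := by
  obtain ⟨U, hUo, hUu, hyes, hno⟩ := h
  exact ⟨U, hUo, hUu, fun n m C x hC =>
    ⟨fun hacc => hyes _ ⟨n, m, C, x, hC, rfl, hacc⟩, fun hacc => hno _ ⟨n, m, C, x, hC, rfl, hacc⟩⟩⟩

/-- **Composition of the birth line** (kernel-checked): piece X₃ (stated verbatim; after the split it is the route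
decl `Theses.AmplitudeProofs.ApcUniversal`) from the two stubs BY NAME. -/
theorem ApcUniversal_of : ∃ U : Literature.Computability.Cryptography.QCircuitFamily Literature.Computability.Cryptography.cliffordT, U.IsOracleFree ∧ U.IsUniform ∧ ∀ (n m : ℕ) (C : Literature.Computability.Cryptography.QCircuit Literature.Computability.Cryptography.cliffordT (n + m)) (x : Literature.Computability.Cryptography.QReg n), C.IsOracleFree → ((2 : ℝ) / 3 ≤ C.acceptProb 0 x → (2 : ℝ) / 3 ≤ U.acceptProbOn 0 (Literature.Computability.Complexity.boolPair (Literature.Computability.Cryptography.QCircuit.sigmaEncode ⟨n, m, C⟩) (List.ofFn x))) ∧ (C.acceptProb 0 x ≤ (1 : ℝ) / 3 → U.acceptProbOn 0 (Literature.Computability.Complexity.boolPair (Literature.Computability.Cryptography.QCircuit.sigmaEncode ⟨n, m, C⟩) (List.ofFn x)) ≤ (1 : ℝ) / 3) :=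
  apcUniversal_of_mem_PromiseBQP (apcPromise_mem_PromiseBQP_of stub_approxUniversal stub_promiseGapAmplification)

end Summit.QuantumAdvantage.QuantumAdvantage.Cruxes.ApcThesis.NpCut.Universal
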